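import Literature.MathematicalPhysics.QuantumFieldTheory.Balaban1983to89.Node00.B7GaugeGroup
import Literature.MathematicalPhysics.QuantumFieldTheory.Balaban1983to89.UnitaryLogSpectralForm
import Literature.MathematicalPhysics.QuantumFieldTheory.Balaban1983to89.B7ConclSubgroup
import Mathlib.Analysis.SpecialFunctions.Log.Deriv
import Mathlib.Analysis.SpecialFunctions.Trigonometric.Inverse
import HarnessLib

/-!
# `SU(N)` IS CLOSED UNDER BAŁABAN'S ONE-STEP AVERAGE (42) AT THE PRINTED RADIUS `¼` EXACTLY FOR `N ≤ 25`
# ([Balaban1985Averaging] pp. 20, 23–26): the `N`-range of the radius-`¼` leaf `b7` at `G = SU(N)` sharpened from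
# `N ≤ 12` (tree) to `N ≤ 25`, with the tree's refutation for `N ≥ 26` making the dichotomy exact

CITATION HEADER.  Source: T. Bałaban, *Averaging operations for lattice gauge theories*, Commun. Math. Phys. **98**,
17–51 (1985) [Balaban1985Averaging], p. 20 («The group `G` is obtained by applying the function `e^{iA}` to `A ∈ 𝔤`»),
(20)–(27) pp. 21–22 (operator norm, the logarithm and its inequalities), (42)–(43) pp. 23–24 (the one-step and `k`-fold
averages), Props. 1–2 p. 26.  Companions USED BY NAME (nothing re-proved): `B7Prop2SpecialUnitary` (lit-balaban b07 gen 15: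
`AvgClosedAt`, `specialUnitaryUnits`, `bavg_mem_specialUnitaryUnits` at radius `t ≤ ¼` WITH `N·t < π`,
`avgClosedAt_specialUnitary`, `AvgClosedAt.avgClosed`, and the NEGATIVE side `not_avgClosed_specialUnitary (26 ≤ N)`),
`B7Prop2Explicit` (gen 14: `AvgClosed`, `bavg_mem_unitaryUnits`, `hol_mem_of`), `B7Prop1Explicit` (`Wcx`, `Xavg`, `bavg`,
`hol`, `seg`, `expUnit`), `Node00.B7GaugeGroup` (`b7Concl_of_avgClosed`, `avgClosed_specialUnitary (N ≤ 12)`), `B7ConclSubgroup` (`concl_specialUnitary`, every `N`; Revision 1),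
`MatrixLog` (`mlog`, `exp_mlog`, `norm_mlog_le_neg_log`, `norm_mlog_le_two_mul`), `MatrixNorms.norm_ntr_le_opNorm` ((20)),
`Literature.Analysis.Matrix.det_exp_eq_exp_trace`, `BlockAveragingFederbushGValued` (`unitaryLogChart`, radius `⅓`),
`UnitaryLogSpectralForm` (lit-balaban p28: `eq_conj_diagonal`, `exp_eq_conj_diagonal`, `norm_conj_diagonal`,
`trace_eq_I_mul_sum_eigenvalues` — print's spectral form (22)–(23)), Mathlib (`Real.abs_log_sub_add_sum_range_le`,
`Complex.norm_exp_I_mul_ofReal_sub_one`, `Real.strictMonoOn_sin`, `Real.sin_gt_sub_cube`, `Complex.exp_eq_one_iff`).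

WHY THIS FILE (located `SU(N)` item of the apex chain, summit use; CORRECTED in Revision 1, §4).  The UV leg of
`route-QuantumFields-BalabanLadder` at a general `SU(N)` (`UVOtherGroups`, stmt-QuantumFields-19356, `SU(N)` part: `UVApexSUN :=
∀ N ≥ 3, YMDAG.UVSplit.UVD59 N`, `Theorems/BalabanLadderUVOtherGroupsDefs`) is fed, node by node, by Track A's NODE-00 dossiers read at
`G = SU(N)`.  For the averaging node N04 the TYPED leaf `B7.Concl` (Props. 1–10 AS TYPED) is ALREADY available at `SU(N)` for EVERY
`N ≥ 1` — `B7ConclSubgroup.concl_specialUnitary` ∕ `Node00.N04_at_run_specialUnitary_all` (the typed propositions read the gauge group on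
the hypothesis side only, antitonely) — so NOTHING in this file is needed for N04 as typed.  What the `N`-range below governs is the
TACIT `G`-VALUEDNESS of the printed averages (42)∕(43) at the lineage's fixed radius `¼` (`AvgClosed d L SU(N)`; p. 20 «The group `G`
is obtained by applying the function `e^{iA}` to `A ∈ 𝔤`»), which is NOT a conjunct of any typed `B7.Prop{k}Printed`
(`B7ConclSubgroup` §4) but is what (10) p. 19 (Haar integration of `δ(VŪ⁻¹)` over `G`) presupposes.  The tree certifies it for
`N ≤ 12` (`Node00.B7GaugeGroup.avgClosed_specialUnitary`) and REFUTES it for `N ≥ 26` (`B7Prop2SpecialUnitary.not_avgClosed_specialUnitary`,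
central element `e^{2πi/N}·1`); THIS FILE closes the window `13 ≤ N ≤ 25`: at radius `¼` the averages of `SU(N)`-valued small
fields are `SU(N)`-valued for every `N ≤ 25`, and ONLY those (`avgClosed_two_two_specialUnitary_iff`); for `N ≥ 26` only a smaller,
`N`-dependent radius serves (`B7Prop2SpecialUnitary` §3–§4, `AvgClosedAt`).

WHAT IS PROVED (0 sorry, standard axioms; `n` a finite index type, `N = card n`, `L²`-operator norm (19)):
* §1 ROUTE A (series bound, elementary): `trace_mlog_eq_zero_of_neg_log` — `det X = 1`, `‖X − 1‖ < 1`,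
  `N·(−log(1 − ‖X − 1‖)) < 2π ⇒ Tr log X = 0` (the tree's argument with the FIRST member of (26), `|log X| ≤ −log(1 − |X − 1|)`,
  instead of the last, `|log X| ≤ 2|X − 1|`); `neg_log_three_quarters_le : −log(3/4) ≤ 7/24`; hence closure at radius `¼` for
  `N ≤ 21` (`avgClosed_specialUnitary_of_le_twentyone`).
* §2 ROUTE B (spectral, SHARP — the located remark «FINDINGS» of `B7Prop2SpecialUnitary`'s header made kernel:
  «the principal logarithm of `W ∈ SU(N)` is traceless for `|W − 1| < 2 sin(π/N)`»): `trace_mlog_eq_zero_of_lt_two_sin` —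
  `W ∈ SU(N)`, `‖W − 1‖ ≤ ⅓`, `‖W − 1‖ < 2 sin(π/N) ⇒ Tr log W = 0`: `log W = g·diag(iθ)·g*` (chart `𝔲(N)`, radius `⅓`),
  `W = e^{log W} = g·diag(e^{iθ})·g*`, `‖W − 1‖ = max_j |e^{iθ_j} − 1| = max_j 2|sin(θ_j/2)|` with `|θ_j| ≤ ‖log W‖ ≤ ⅔`, so
  `|θ_j| < 2π/N`, `|Σ_j θ_j| < 2π`, while `e^{iΣθ_j} = det W = 1`; hence `Σθ_j = 0 = Tr log W`.
* §3 CLOSURE: `bavg_mem_specialUnitaryUnits_of_lt_two_sin`, `avgClosedAt_specialUnitary_of_lt_two_sin` (radius `t ≤ ¼`,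
  `t < 2 sin(π/N)`); `two_sin_pi_div_gt_quarter (N ≤ 25) : ¼ < 2 sin(π/N)`; **`avgClosed_specialUnitary_of_le (N ≤ 25)`**;
  **`avgClosed_two_two_specialUnitary_iff : AvgClosed 2 2 SU(N) ↔ N ≤ 25`** (with the tree's `not_avgClosed_specialUnitary`);
  `b7Concl_specialUnitary_of_le (N ≤ 25)` — `B7.Concl` AS TYPED through the closure route (the tree's `Node00.b7Concl_specialUnitary`
  with `12 ↦ 25`); NB this is a SPECIAL CASE of the tree's `B7ConclSubgroup.concl_specialUnitary` (every `N`, antitonicity route) and is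
  kept only as the closure-route reading — see §4.
* §4 (Revision 1, same sitting) LOCATED PRECISION: `concl_all_and_avgClosed_iff` records side by side «`B7.Concl` AS TYPED at `SU(N)` for
  EVERY `N`» (tree) and «the averages are `SU(N)`-valued at radius `¼` iff `N ≤ 25`» (this file).
* §5 (Revision 2) THE EXACT RADIUS: `norm_ZU_sub_one_eq : |Z − 1| = 2 sin(π/N)`, `not_avgClosedAt_specialUnitary_of_two_sin_le` (`N ≥ 10`,
  `t ≥ 2 sin(π/N)`), **`avgClosedAt_two_two_specialUnitary_iff (2 ≤ N) (t ≤ ¼) : AvgClosedAt 2 t 2 SU(N) ↔ t < 2 sin(π/N)`** — the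
  `G`-dependent radius of p. 20 for `G = SU(N)` is exactly `min{¼, 2 sin(π/N)}`.

HONEST SCOPE.  (i) A statement about the DEFINITIONS (42)/(52) at the lineage's fixed radius `¼` and `G = SU(N) ⊂ M_N(ℂ)`;
no printed claim is contradicted or extended (print fixes no radius; its tacit `G`-valuedness holds at a `G`-dependent radius,
`B7Prop2SpecialUnitary` §3–§4).  (ii) For `N ≥ 26` nothing new: the averages are `SU(N)`-valued only below the `N`-dependent radius of
`B7Prop2SpecialUnitary` §3 (`AvgClosedAt`); the typed leaf itself needs no radius (`B7ConclSubgroup`).  (iii) Summit framing: bookkeeping of a CONDITIONAL chain (which `N` the existing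
typed leaf serves); nothing here is an estimate of Bałaban's renormalisation group, a continuum limit, or a Clay claim.
Seat ym-osasm-p2 g5 (R136 (iii), `--supports stmt-QuantumFields-19356`), 2026-08-27.
-/

noncomputable section

open scoped BigOperators
open NormedSpace Finset

namespace Literature.MathematicalPhysics.QuantumFieldTheory.Balaban1983to89.B7AvgClosedSpecialUnitarySharp

open B7Prop1Explicit B7Prop2Explicit B7Prop2SpecialUnitary MatrixLog
open B7ConclOneStep B7ConclKExp B7ConclGauge B7ConclConcrete
open Literature.Analysis.Matrix (det_exp_eq_exp_trace)

-- `Site` alone would resolve to the torus sites of `Setup.lean`; re-export the `ℤ^d` sites of `B7Prop1Explicit`.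
export B7Prop1Explicit (Site)

variable {d : ℕ}

/-! ## §0 Two numerical facts and two elementary inequalities -/

section Numerics

/-- `−log(3/4) ≤ 7/24` (= 0.2916…; true value 0.2877): the third Taylor remainder of `−log(1 − x)` at `x = ¼`
(Mathlib `Real.abs_log_sub_add_sum_range_le`: `|Σ_{i<3} x^{i+1}/(i+1) + log(1 − x)| ≤ x⁴/(1 − x)`). [folklore] -/
private theorem neg_log_three_quarters_le : -Real.log (1 - 1 / 4) ≤ 7 / 24 := by
  have hx : |(1 / 4 : ℝ)| < 1 := by rw [abs_of_pos (by norm_num)]; norm_num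
  have h := Real.abs_log_sub_add_sum_range_le hx 3
  rw [abs_of_pos (by norm_num : (0 : ℝ) < 1 / 4)] at h
  have h' := (abs_le.1 h).1
  simp only [Finset.sum_range_succ, Finset.sum_range_zero] at h'
  norm_num at h'
  linarith

/-- `x ↦ −log(1 − x)` is monotone on `x < 1`. [folklore] -/
private theorem neg_log_one_sub_mono {s t : ℝ} (hst : s ≤ t) (ht : t < 1) : -Real.log (1 - s) ≤ -Real.log (1 - t) := by
  have := Real.log_le_log (by linarith) (by linarith : 1 - t ≤ 1 - s)
  linarith

/-- **`¼ < 2 sin(π/N)` for `2 ≤ N ≤ 25`** (`sin(π/25) > π/25 − (π/25)³/6 > 0.1252 > ⅛` from `3.14 < π < 3.15`, and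
`sin(π/25) ≤ sin(π/N)` by monotonicity of `sin` on `[0, π/2]`; `N = 1` is excluded since `sin π = 0`). [folklore] -/
private theorem quarter_lt_two_sin_pi_div {N : ℕ} (hN2 : 2 ≤ N) (hN : N ≤ 25) :
    (1 / 4 : ℝ) < 2 * Real.sin (Real.pi / N) := by
  have hπ1 := Real.pi_gt_d2
  have hπ2 := Real.pi_lt_d2
  have hN0 : (0 : ℝ) < N := by exact_mod_cast (lt_of_lt_of_le (by norm_num) hN2)
  have hNr : (N : ℝ) ≤ 25 := by exact_mod_cast hN
  have hN2r : (2 : ℝ) ≤ N := by exact_mod_cast hN2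
  -- `π/25 ≤ π/N ≤ π/2`
  have hlo : Real.pi / 25 ≤ Real.pi / N := div_le_div_of_nonneg_left Real.pi_pos.le hN0 hNr
  have hhi : Real.pi / N ≤ Real.pi / 2 := div_le_div_of_nonneg_left Real.pi_pos.le (by norm_num) hN2r
  -- `sin(π/25) ≤ sin(π/N)`
  have hmono : Real.sin (Real.pi / 25) ≤ Real.sin (Real.pi / N) := by
    apply Real.strictMonoOn_sin.monotoneOn
    · constructor <;> nlinarith [Real.pi_pos]
    · constructor <;> nlinarith [Real.pi_pos]
    · exact hlo
  -- `sin(π/25) > π/25 − (π/25)³/6 > ⅛`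
  have hx0 : (0 : ℝ) < Real.pi / 25 := by positivity
  have hcube := Real.sin_gt_sub_cube hx0
  have hxlo : (0.1256 : ℝ) < Real.pi / 25 := by linarith
  have hxhi : Real.pi / 25 < (0.126 : ℝ) := by linarith
  have hx3 : (Real.pi / 25) ^ 3 < (0.126 : ℝ) ^ 3 := by
    exact pow_lt_pow_left₀ hxhi hx0.le (by norm_num)
  have h8 : (1 / 8 : ℝ) < Real.sin (Real.pi / 25) := by nlinarith
  linarith

end Numerics

/-! ## §1 ROUTE A — `Tr log X = 0` from the series bound `|log X| ≤ −log(1 − |X − 1|)`; radius `¼` for `N ≤ 21` -/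

section RouteA

open scoped Matrix.Norms.L2Operator

variable {n : Type*} [Fintype n] [DecidableEq n]

/-- From `e^{z} = 1` and `‖z‖ < 2π`: `z = 0`. [folklore] -/
private theorem eq_zero_of_exp_eq_one_of_norm_lt {z : ℂ} (hz : Complex.exp z = 1) (hbd : ‖z‖ < 2 * Real.pi) : z = 0 := by
  obtain ⟨k, hk⟩ := Complex.exp_eq_one_iff.1 hz
  have hk0 : k = 0 := by
    have h2π : ‖(k : ℂ) * (2 * Real.pi * Complex.I)‖ < 2 * Real.pi := by rw [← hk]; exact hbd
    have hn : ‖(2 * Real.pi * Complex.I : ℂ)‖ = 2 * Real.pi := by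
      simp [abs_of_pos Real.pi_pos]
    rw [norm_mul, hn, Complex.norm_intCast] at h2π
    have hk1 : |(k : ℝ)| < 1 := (mul_lt_iff_lt_one_left (by positivity)).1 h2π
    have : |k| < 1 := by exact_mod_cast hk1
    exact Int.abs_lt_one_iff.1 this
  rw [hk, hk0]
  simp

/-- **ROUTE A**: `det X = 1`, `‖X − 1‖ < 1` and `N·(−log(1 − ‖X − 1‖)) < 2π` imply `Tr log X = 0`
(`e^{Tr log X} = det e^{log X} = det X = 1` and `|Tr log X| ≤ N|log X| ≤ N·(−log(1 − |X − 1|)) < 2π` — the FIRST member of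
(26) p. 22 instead of the last). [cite: Balaban1985Averaging, (26) p.22, (20)–(23) p.21] -/
theorem trace_mlog_eq_zero_of_neg_log {X : Matrix n n ℂ} (hX : X.det = 1) (hX1 : ‖X - 1‖ < 1)
    (hπ : Fintype.card n * (-Real.log (1 - ‖X - 1‖)) < 2 * Real.pi) : (mlog X).trace = 0 := by
  have hexp : Complex.exp (mlog X).trace = 1 := by
    rw [Complex.exp_eq_exp_ℂ, ← det_exp_eq_exp_trace, exp_mlog hX1]
    exact hX
  refine eq_zero_of_exp_eq_one_of_norm_lt hexp ?_
  -- `|Tr M| ≤ N‖M‖` ((20) p. 21; the tree's `QuantumLattice.norm_trace_le_card_mul_norm`, whose Lee–Yang module is not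
  -- imported here to keep the closure small — the same device as `ExpMeanLog.trace_mlog_eq_zero`)
  have h1 : ‖(mlog X).trace‖ ≤ Fintype.card n * ‖mlog X‖ := by
    rcases isEmpty_or_nonempty n with hn | hn
    · simp [Matrix.trace]
    have hc : (0 : ℝ) < Fintype.card n := Nat.cast_pos.mpr Fintype.card_pos
    have h : ‖(mlog X).trace / (Fintype.card n : ℂ)‖ ≤ ‖mlog X‖ := MatrixNorms.norm_ntr_le_opNorm (mlog X)
    rw [norm_div, Complex.norm_natCast, div_le_iff₀ hc] at h
    linarith [mul_comm (Fintype.card n : ℝ) ‖mlog X‖]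
  have h2 : ‖mlog X‖ ≤ -Real.log (1 - ‖X - 1‖) := norm_mlog_le_neg_log hX1
  have hc : (0 : ℝ) ≤ Fintype.card n := Nat.cast_nonneg _
  nlinarith [mul_le_mul_of_nonneg_left h2 hc]

/-- **The average (42) of an `SU(N)`-valued configuration is `SU(N)`-valued at radius `t ≤ ¼` whenever
`N·(−log(1 − t)) < 2π`** (the tree's `bavg_mem_specialUnitaryUnits` with Route A in place of `N·t < π`).
[cite: Balaban1985Averaging, (42) p.23, p.20, (20)–(26) pp.21–22] -/
theorem bavg_mem_specialUnitaryUnits_of_neg_log {V : Site d → Fin d → (Matrix n n ℂ)ˣ}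
    (hV : ∀ x κ, V x κ ∈ specialUnitaryUnits n) (L : ℕ) (q : Site d) (κ : Fin d) {t : ℝ} (ht4 : t ≤ 1 / 4)
    (htπ : Fintype.card n * (-Real.log (1 - t)) < 2 * Real.pi)
    (hW : ∀ r : Fin d → Fin L, ‖((Wcx L V q κ (boxVec L r) : (Matrix n n ℂ)ˣ) : Matrix n n ℂ) - 1‖ ≤ t) :
    bavg L V q κ ∈ specialUnitaryUnits n := by
  letI : CStarAlgebra (Matrix n n ℂ) := {}
  have ht1 : t < 1 := lt_of_le_of_lt ht4 (by norm_num)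
  have hVU : ∀ x κ, V x κ ∈ unitaryUnits (Matrix n n ℂ) := fun x κ =>
    specialUnitaryUnits_le_unitaryUnits (hV x κ)
  have hU : bavg L V q κ ∈ unitaryUnits (Matrix n n ℂ) :=
    bavg_mem_unitaryUnits hVU L q κ fun r => (hW r).trans ht4
  have hWm : ∀ r : Fin d → Fin L, Wcx L V q κ (boxVec L r) ∈ specialUnitaryUnits n := fun r =>
    (specialUnitaryUnits n).mul_mem (hol_mem_of hV _ _) ((specialUnitaryUnits n).inv_mem (hol_mem_of hV _ _))
  have htr : ∀ r : Fin d → Fin L,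
      (mlog ((Wcx L V q κ (boxVec L r) : (Matrix n n ℂ)ˣ) : Matrix n n ℂ)).trace = 0 := fun r => by
    refine trace_mlog_eq_zero_of_neg_log (Matrix.mem_specialUnitaryGroup_iff.1 (hWm r)).2
      ((hW r).trans_lt ht1) (lt_of_le_of_lt ?_ htπ)
    exact mul_le_mul_of_nonneg_left (neg_log_one_sub_mono (hW r) ht1) (Nat.cast_nonneg _)
  have hX : (Xavg L V q κ).trace = 0 := by
    unfold Xavg
    rw [Matrix.trace_sum]
    exact Finset.sum_eq_zero fun r _ => by rw [Matrix.trace_smul, htr r, smul_zero]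
  have hdet : ((hol V q (seg κ L) : (Matrix n n ℂ)ˣ) : Matrix n n ℂ).det = 1 :=
    (Matrix.mem_specialUnitaryGroup_iff.1 (hol_mem_of hV q (seg κ L))).2
  rw [mem_specialUnitaryUnits, Matrix.mem_specialUnitaryGroup_iff]
  refine ⟨hU, ?_⟩
  show ((expUnit (Xavg L V q κ) * hol V q (seg κ L) : (Matrix n n ℂ)ˣ) : Matrix n n ℂ).det = 1
  rw [Units.val_mul, Matrix.det_mul, hdet, mul_one, val_expUnit, det_exp_eq_exp_trace, hX, exp_zero]

variable [Nonempty n]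

variable (d) in
/-- **`SU(N)` is `AvgClosedAt d t L` for every radius `t ≤ ¼` with `N·(−log(1 − t)) < 2π`.**
[cite: Balaban1985Averaging, (42)–(43) pp.23–24, p.20] -/
theorem avgClosedAt_specialUnitary_of_neg_log (L : ℕ) {t : ℝ} (ht4 : t ≤ 1 / 4)
    (htπ : Fintype.card n * (-Real.log (1 - t)) < 2 * Real.pi) :
    AvgClosedAt d t L (specialUnitaryUnits n) :=
  ⟨specialUnitaryUnits_le_U1, fun _ hV q κ hW => bavg_mem_specialUnitaryUnits_of_neg_log hV _ q κ ht4 htπ hW⟩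

/-- **`SU(N)` is closed under the one-step average (42) at the lineage's radius `¼` for every `N ≤ 21`** (Route A:
`21 · 7/24 = 6.125 < 2π`). [cite: Balaban1985Averaging, (42)–(43) pp.23–24, p.20] -/
theorem avgClosed_specialUnitary_of_le_twentyone {N : ℕ} [NeZero N] (hN : N ≤ 21) (d L : ℕ) :
    AvgClosed d L (specialUnitaryUnits (Fin N)) := by
  have hπ : (Fintype.card (Fin N) : ℝ) * (-Real.log (1 - 1 / 4)) < 2 * Real.pi := by
    have hN' : (N : ℝ) ≤ 21 := by exact_mod_cast hN
    have hl := neg_log_three_quarters_le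
    have hl0 : 0 ≤ -Real.log (1 - 1 / 4) := by
      have := Real.log_le_sub_one_of_pos (by norm_num : (0 : ℝ) < 1 - 1 / 4)
      linarith
    rw [Fintype.card_fin]
    nlinarith [Real.pi_gt_d2, mul_le_mul hN' hl hl0 (by norm_num : (0 : ℝ) ≤ 21)]
  exact (avgClosedAt_specialUnitary_of_neg_log d L le_rfl hπ).avgClosed le_rfl

end RouteA

/-! ## §2 ROUTE B — the spectral form: `Tr log W = 0` for `W ∈ SU(N)` with `|W − 1| < 2 sin(π/N)` (SHARP) -/

section RouteB

open scoped Matrix.Norms.L2Operator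
open Complex (I)
open UnitaryLogSpectralForm (eq_conj_diagonal exp_eq_conj_diagonal norm_conj_diagonal trace_eq_I_mul_sum_eigenvalues)
open HaarDensityUnitaryChart (conjTranspose_eq_neg_of_mem_unitaryLogChart)
open HaarDensityUnitaryExplicit (isHermitian_neg_I_smul)

variable {n : Type*} [Fintype n] [DecidableEq n]

/-- `g·D·g* − 1 = g·(D − 1)·g*` for unitary `g`. [folklore] -/
private theorem conj_sub_one {g D : Matrix n n ℂ} (hg : g ∈ Matrix.unitaryGroup n ℂ) :
    g * D * star g - 1 = g * (D - 1) * star g := by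
  have hgg : g * star g = 1 := Matrix.mem_unitaryGroup_iff.1 hg
  rw [Matrix.mul_sub, Matrix.sub_mul, Matrix.mul_one, hgg]

/-- **ROUTE B, THE SHARP TRACE LEMMA**: for `W ∈ SU(N)` with `‖W − 1‖ ≤ ⅓` and `‖W − 1‖ < 2 sin(π/N)`, `Tr log W = 0`
(`log` = the series (21)).  Print's spectral form (22)–(23): `log W = g·diag(iθ)·g*`, `W = g·diag(e^{iθ})·g*`,
`|W − 1| = max_j |e^{iθ_j} − 1| = max_j 2|sin(θ_j/2)|` with `|θ_j| ≤ |log W| ≤ ⅔`, so `|θ_j| < 2π/N` and `|Σ_j θ_j| < 2π`;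
`e^{iΣθ_j} = det W = 1` forces `Σ_j θ_j = 0`.  The threshold is sharp: the central `e^{2πi/N}·1` has `|· − 1| = 2 sin(π/N)`
and `Tr log = 2πi` (`B7Prop2SpecialUnitary` §5). [cite: Balaban1985Averaging, (22)–(23) p.21, p.20] -/
theorem trace_mlog_eq_zero_of_lt_two_sin {W : Matrix n n ℂ} (hW : W ∈ Matrix.specialUnitaryGroup n ℂ)
    (hW3 : ‖W - 1‖ ≤ 1 / 3) (hsin : ‖W - 1‖ < 2 * Real.sin (Real.pi / Fintype.card n)) :
    (mlog W).trace = 0 := by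
  have hWu : W ∈ Matrix.unitaryGroup n ℂ := (Matrix.mem_specialUnitaryGroup_iff.1 hW).1
  have hWdet : W.det = 1 := (Matrix.mem_specialUnitaryGroup_iff.1 hW).2
  have hW1 : ‖W - 1‖ < 1 := lt_of_le_of_lt hW3 (by norm_num)
  -- `log W ∈ 𝔲(N)` (the `U(N)` chart, radius `⅓`)
  have hA : mlog W ∈ (unitaryLogChart n).lie :=
    (unitaryLogChart n).mlog_mem (show W ∈ (unitaryLogChart n).carrier from hWu) (by rw [unitaryLogChart_ρ]; exact hW3)
  set A : (unitaryLogChart n).lie := ⟨mlog W, hA⟩ with hAdef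
  have hAval : (A : Matrix n n ℂ) = mlog W := rfl
  -- the spectral data of `A`
  set hH := isHermitian_neg_I_smul (conjTranspose_eq_neg_of_mem_unitaryLogChart A) with hHdef
  set g : Matrix n n ℂ := (hH.eigenvectorUnitary : Matrix n n ℂ) with hgdef
  set θ : n → ℝ := hH.eigenvalues with hθdef
  have hg : g ∈ Matrix.unitaryGroup n ℂ := hH.eigenvectorUnitary.2
  have hAeq : mlog W = g * Matrix.diagonal (fun j => I * (θ j : ℂ)) * star g := by
    rw [← hAval]; exact eq_conj_diagonal A
  have hexpA : NormedSpace.exp (mlog W) = g * Matrix.diagonal (fun j => Complex.exp (I * (θ j : ℂ))) * star g := by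
    rw [← hAval]; exact exp_eq_conj_diagonal A
  have hWeq : W = g * Matrix.diagonal (fun j => Complex.exp (I * (θ j : ℂ))) * star g := by
    rw [← hexpA, exp_mlog hW1]
  -- `‖W − 1‖ = max_j |e^{iθ_j} − 1|` and `‖log W‖ = max_j |θ_j|`
  have hnormW : ‖W - 1‖ = ‖fun j => Complex.exp (I * (θ j : ℂ)) - 1‖ := by
    conv_lhs => rw [hWeq, conj_sub_one hg]
    rw [show Matrix.diagonal (fun j => Complex.exp (I * (θ j : ℂ))) - (1 : Matrix n n ℂ) =
        Matrix.diagonal (fun j => Complex.exp (I * (θ j : ℂ)) - 1) by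
      rw [← Matrix.diagonal_one, ← Matrix.diagonal_sub]]
    exact norm_conj_diagonal hg _
  have hnormA : ‖mlog W‖ = ‖fun j => I * (θ j : ℂ)‖ := by
    conv_lhs => rw [hAeq]
    exact norm_conj_diagonal hg _
  -- each `θ_j`: `|θ_j| ≤ ⅔` and `2|sin(θ_j/2)| < 2 sin(π/N)`
  have hθbd : ∀ j, |θ j| ≤ 2 / 3 := fun j => by
    have h1 : ‖I * (θ j : ℂ)‖ ≤ ‖fun j => I * (θ j : ℂ)‖ := norm_le_pi_norm (fun j => I * (θ j : ℂ)) j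
    rw [norm_mul, Complex.norm_I, one_mul, Complex.norm_real, Real.norm_eq_abs, ← hnormA] at h1
    have h2 : ‖mlog W‖ ≤ 2 * ‖W - 1‖ := norm_mlog_le_two_mul (hW3.trans (by norm_num))
    linarith
  have hθsin : ∀ j, 2 * |Real.sin (θ j / 2)| < 2 * Real.sin (Real.pi / Fintype.card n) := fun j => by
    have h1 : ‖Complex.exp (I * (θ j : ℂ)) - 1‖ ≤ ‖fun j => Complex.exp (I * (θ j : ℂ)) - 1‖ :=
      norm_le_pi_norm (fun j => Complex.exp (I * (θ j : ℂ)) - 1) j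
    rw [Complex.norm_exp_I_mul_ofReal_sub_one, ← hnormW] at h1
    have h2 : ‖(2 : ℝ) * Real.sin (θ j / 2)‖ = 2 * |Real.sin (θ j / 2)| := by
      rw [Real.norm_eq_abs, abs_mul, abs_of_pos (by norm_num : (0 : ℝ) < 2)]
    rw [h2] at h1
    exact lt_of_le_of_lt h1 hsin
  -- the index type is nonempty (else `W = 1` and everything is `0`), and then `N ≥ 1`; we need `π/N ≤ π/2` unless `N = 1`
  rcases isEmpty_or_nonempty n with hn | hn
  · simp [Matrix.trace]
  have hN0 : (0 : ℝ) < Fintype.card n := Nat.cast_pos.mpr Fintype.card_pos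
  -- `|θ_j| < 2π/N` for every `j`
  have hθlt : ∀ j, |θ j| < 2 * Real.pi / Fintype.card n := fun j => by
    by_cases hN1 : Fintype.card n = 1
    · -- `N = 1`: `|θ_j| ≤ ⅔ < 2π`
      rw [hN1]; simp only [Nat.cast_one, div_one]
      linarith [hθbd j, Real.pi_gt_three]
    · have hN2 : (2 : ℝ) ≤ Fintype.card n := by
        have : 2 ≤ Fintype.card n := by
          have := Fintype.card_pos (α := n); omega
        exact_mod_cast this
      have hhi : Real.pi / Fintype.card n ≤ Real.pi / 2 :=
        div_le_div_of_nonneg_left Real.pi_pos.le (by norm_num) hN2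
      -- `sin(|θ_j|/2) = |sin(θ_j/2)| < sin(π/N)` with both arguments in `[−π/2, π/2]`
      have habs : |Real.sin (θ j / 2)| = Real.sin (|θ j| / 2) := by
        rcases le_or_gt 0 (θ j) with h0 | h0
        · rw [abs_of_nonneg h0, abs_of_nonneg]
          apply Real.sin_nonneg_of_nonneg_of_le_pi <;> nlinarith [hθbd j, Real.pi_gt_three, abs_of_nonneg h0]
        · rw [abs_of_neg h0, show -θ j / 2 = -(θ j / 2) by ring, Real.sin_neg, abs_of_nonpos]
          apply Real.sin_nonpos_of_nonpos_of_neg_pi_le <;> nlinarith [hθbd j, Real.pi_gt_three, abs_of_neg h0]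
      have hlt : Real.sin (|θ j| / 2) < Real.sin (Real.pi / Fintype.card n) := by
        have := hθsin j; rw [habs] at this; linarith
      have hmem1 : |θ j| / 2 ∈ Set.Icc (-(Real.pi / 2)) (Real.pi / 2) := by
        constructor <;> nlinarith [hθbd j, Real.pi_gt_three, abs_nonneg (θ j)]
      have hmem2 : Real.pi / Fintype.card n ∈ Set.Icc (-(Real.pi / 2)) (Real.pi / 2) := by
        constructor
        · nlinarith [Real.pi_pos, div_pos Real.pi_pos hN0]
        · exact hhi
      have := (Real.strictMonoOn_sin.lt_iff_lt hmem1 hmem2).1 hlt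
      rw [lt_div_iff₀ hN0] at this ⊢
      nlinarith
  -- `|Σ θ_j| < 2π`
  have hsum : |∑ j, θ j| < 2 * Real.pi := by
    calc |∑ j, θ j| ≤ ∑ j, |θ j| := Finset.abs_sum_le_sum_abs _ _
      _ < ∑ _j : n, 2 * Real.pi / Fintype.card n := by
          apply Finset.sum_lt_sum_of_nonempty Finset.univ_nonempty
          intro j _; exact hθlt j
      _ = 2 * Real.pi := by
          rw [Finset.sum_const, Finset.card_univ, nsmul_eq_mul]; field_simp
  -- `Tr log W = iΣθ_j` and `e^{Tr log W} = det W = 1`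
  have htr : (mlog W).trace = I * ∑ j, (θ j : ℂ) := by
    rw [← hAval]; exact trace_eq_I_mul_sum_eigenvalues A
  have hexp : Complex.exp (mlog W).trace = 1 := by
    rw [Complex.exp_eq_exp_ℂ, ← det_exp_eq_exp_trace, exp_mlog hW1]
    exact hWdet
  refine eq_zero_of_exp_eq_one_of_norm_lt hexp ?_
  rw [htr, norm_mul, Complex.norm_I, one_mul, ← Complex.ofReal_sum, Complex.norm_real, Real.norm_eq_abs]
  exact hsum

/-- **The average (42) of an `SU(N)`-valued configuration is `SU(N)`-valued at every radius `t ≤ ¼` with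
`t < 2 sin(π/N)`** (Route B in the tree's `bavg_mem_specialUnitaryUnits`). [cite: Balaban1985Averaging, (42) p.23, p.20, (22)–(23) p.21] -/
theorem bavg_mem_specialUnitaryUnits_of_lt_two_sin {V : Site d → Fin d → (Matrix n n ℂ)ˣ}
    (hV : ∀ x κ, V x κ ∈ specialUnitaryUnits n) (L : ℕ) (q : Site d) (κ : Fin d) {t : ℝ} (ht4 : t ≤ 1 / 4)
    (htsin : t < 2 * Real.sin (Real.pi / Fintype.card n))
    (hW : ∀ r : Fin d → Fin L, ‖((Wcx L V q κ (boxVec L r) : (Matrix n n ℂ)ˣ) : Matrix n n ℂ) - 1‖ ≤ t) :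
    bavg L V q κ ∈ specialUnitaryUnits n := by
  letI : CStarAlgebra (Matrix n n ℂ) := {}
  have hVU : ∀ x κ, V x κ ∈ unitaryUnits (Matrix n n ℂ) := fun x κ =>
    specialUnitaryUnits_le_unitaryUnits (hV x κ)
  have hU : bavg L V q κ ∈ unitaryUnits (Matrix n n ℂ) :=
    bavg_mem_unitaryUnits hVU L q κ fun r => (hW r).trans ht4
  have hWm : ∀ r : Fin d → Fin L, Wcx L V q κ (boxVec L r) ∈ specialUnitaryUnits n := fun r =>
    (specialUnitaryUnits n).mul_mem (hol_mem_of hV _ _) ((specialUnitaryUnits n).inv_mem (hol_mem_of hV _ _))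
  have htr : ∀ r : Fin d → Fin L,
      (mlog ((Wcx L V q κ (boxVec L r) : (Matrix n n ℂ)ˣ) : Matrix n n ℂ)).trace = 0 := fun r =>
    trace_mlog_eq_zero_of_lt_two_sin (hWm r) ((hW r).trans (ht4.trans (by norm_num)))
      (lt_of_le_of_lt (hW r) htsin)
  have hX : (Xavg L V q κ).trace = 0 := by
    unfold Xavg
    rw [Matrix.trace_sum]
    exact Finset.sum_eq_zero fun r _ => by rw [Matrix.trace_smul, htr r, smul_zero]
  have hdet : ((hol V q (seg κ L) : (Matrix n n ℂ)ˣ) : Matrix n n ℂ).det = 1 :=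
    (Matrix.mem_specialUnitaryGroup_iff.1 (hol_mem_of hV q (seg κ L))).2
  rw [mem_specialUnitaryUnits, Matrix.mem_specialUnitaryGroup_iff]
  refine ⟨hU, ?_⟩
  show ((expUnit (Xavg L V q κ) * hol V q (seg κ L) : (Matrix n n ℂ)ˣ) : Matrix n n ℂ).det = 1
  rw [Units.val_mul, Matrix.det_mul, hdet, mul_one, val_expUnit, det_exp_eq_exp_trace, hX, exp_zero]

variable [Nonempty n]

variable (d) in
/-- **`SU(N)` is `AvgClosedAt d t L` for every radius `t ≤ ¼` with `t < 2 sin(π/N)`** (the threshold `2 sin(π/N)` is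
the one of the central-element witness `Z = e^{2πi/N}·1`, `|Z − 1| = 2 sin(π/N)`, of `B7Prop2SpecialUnitary` §5, whose
`not_avgClosedAt_specialUnitary` refutes every `t ≥ 2π/N`). [cite: Balaban1985Averaging, (42)–(43) pp.23–24, p.20] -/
theorem avgClosedAt_specialUnitary_of_lt_two_sin (L : ℕ) {t : ℝ} (ht4 : t ≤ 1 / 4)
    (htsin : t < 2 * Real.sin (Real.pi / Fintype.card n)) :
    AvgClosedAt d t L (specialUnitaryUnits n) :=
  ⟨specialUnitaryUnits_le_U1, fun _ hV q κ hW => bavg_mem_specialUnitaryUnits_of_lt_two_sin hV _ q κ ht4 htsin hW⟩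

end RouteB

/-! ## §3 The exact `N`-range of the radius-`¼` leaf at `SU(N)`: `N ≤ 25` -/

section Range

open scoped Matrix.Norms.L2Operator

/-- **`SU(N)` IS CLOSED UNDER THE ONE-STEP AVERAGE (42) AT THE LINEAGE'S RADIUS `¼` FOR EVERY `N ≤ 25`**
(`N ≤ 12`: the tree; `2 ≤ N ≤ 25`: Route B with `¼ < 2 sin(π/N)`). [cite: Balaban1985Averaging, (42)–(43) pp.23–24, p.20] -/
theorem avgClosed_specialUnitary_of_le {N : ℕ} [NeZero N] (hN : N ≤ 25) (d L : ℕ) :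
    AvgClosed d L (specialUnitaryUnits (Fin N)) := by
  by_cases h12 : N ≤ 12
  · exact Node00.avgClosed_specialUnitary h12 d L
  · have hN2 : 2 ≤ N := by omega
    have hsin : (1 / 4 : ℝ) < 2 * Real.sin (Real.pi / Fintype.card (Fin N)) := by
      rw [Fintype.card_fin]; exact quarter_lt_two_sin_pi_div hN2 hN
    exact (avgClosedAt_specialUnitary_of_lt_two_sin d L le_rfl hsin).avgClosed le_rfl

/-- **THE EXACT DICHOTOMY at `d = 2`, `L = 2`: `SU(N)` is `AvgClosed` at radius `¼` iff `N ≤ 25`** (the positive side for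
every `d`, `L` is `avgClosed_specialUnitary_of_le`; the negative side is the tree's kernel counterexample
`B7Prop2SpecialUnitary.not_avgClosed_specialUnitary`, the central element `e^{2πi/N}·1` on `ℤ²`).
[cite: Balaban1985Averaging, (42) p.23, (52) p.26, p.20] -/
theorem avgClosed_two_two_specialUnitary_iff {N : ℕ} [NeZero N] :
    AvgClosed 2 2 (specialUnitaryUnits (Fin N)) ↔ N ≤ 25 := by
  constructor
  · intro h
    by_contra hN
    exact not_avgClosed_specialUnitary (by omega) h
  · intro hN
    exact avgClosed_specialUnitary_of_le hN 2 2

/-- **`B7.Concl` (Props. 1–10 of [Balaban1985Averaging] AS TYPED) for `SU(N)`-valued configurations with `SU(N)`-valued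
`k`-fold averages, `𝔸 = M_N(ℂ)` with the operator norm (19), EVERY `1 ≤ N ≤ 25`, every `d`, every `L ≥ 2`, with the PRINTED
`N`-independent constants** `c₂ = min{1/(3C₀), ½c₂′}`, `C₀ = 14464(d+1)²(d+4)²`, `c₂′ = 1/(512(d+1)(d+4)L²)` — the tree's
`Node00.b7Concl_specialUnitary` (`N ≤ 12`) with its `N`-range sharpened to the exact one of the radius-`¼` assembly.
[cite: Balaban1985Averaging, Props. 1–10 pp.26–50, setting pp.18–21 (17)–(19)] -/
theorem b7Concl_specialUnitary_of_le (N : ℕ) [NeZero N] (hN : N ≤ 25) (d L : ℕ) (hL : 2 ≤ L) :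
    letI : CStarAlgebra (Matrix (Fin N) (Fin N) ℂ) := {}
    B7.Concl (L : ℝ) (cB d L) (C0 d) (c2' d L)
      (concreteOneStepBD (Matrix (Fin N) (Fin N) ℂ) (d := d) L)
      (fun k : ℕ => concreteKStep d (Matrix (Fin N) (Fin N) ℂ) (specialUnitaryUnits (Fin N)) L k)
      (concreteKExp (Matrix (Fin N) (Fin N) ℂ) (specialUnitaryUnits (Fin N)) (d := d) L)
      (concreteGaugeData (Matrix (Fin N) (Fin N) ℂ) (d := d) L)
      (concreteGaugeOneStep (Matrix (Fin N) (Fin N) ℂ) (d := d) L) := by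
  letI : CStarAlgebra (Matrix (Fin N) (Fin N) ℂ) := {}
  exact Node00.b7Concl_of_avgClosed d L hL (Matrix (Fin N) (Fin N) ℂ) (avgClosed_specialUnitary_of_le hN d L)

end Range

/-! ## §4 (Revision 1) LOCATED PRECISION — what the `N`-range does and does not govern

The module header of Revision 0 said the typed leaf `b7` «is available at `SU(N)` exactly where `SU(N)` is `AvgClosed` at the lineage's
radius `¼`».  That sentence was WRONG and is corrected above: the TYPED leaf `B7.Concl` holds at the `SU(N)`-read carriers for EVERY
`N ≥ 1` by antitonicity in the gauge group (`B7ConclSubgroup.concl_specialUnitary`, in the tree since 2026-08-25, consumed by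
`Node00.N04_at_run_specialUnitary_all`), because no typed proposition carries the `G`-valuedness of the averages as a conjunct.
What IS governed by `N ≤ 25` is that tacit `G`-valuedness at the fixed radius `¼` (`AvgClosed`), i.e. the property (10) p. 19
presupposes when it integrates `δ(VŪ⁻¹)` against Haar measure OF `G`.  The theorem below records both kernel facts side by side,
in the manner of `B7ConclSubgroup.concl_specialUnitary_and_caveat`. -/

section Precision

open scoped Matrix.Norms.L2Operator
open B7ConclSubgroup (concl_specialUnitary)

/-- **Side by side, for every `N ≥ 1`:** (a) `B7.Concl` (Props. 1–10 AS TYPED, printed `N`-independent constants) at the `SU(N)`-read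
concrete carriers on `ℤ²`, `L = 2` — the tree's `B7ConclSubgroup.concl_specialUnitary`, NO `N`-restriction; (b) the one-step averages (42)
of `SU(N)`-valued configurations with `¼`-small comb words are `SU(N)`-valued (`AvgClosed 2 2 SU(N)`) **iff `N ≤ 25`** (this file).  So the
`N`-range is a statement about the tacit `G`-valuedness of the averaging operation, not about the typed propositions.
[cite: Balaban1985Averaging, Props. 1–10 pp.26–50, (10) p.19, p.20, (42) p.23] -/
theorem concl_all_and_avgClosed_iff (N : ℕ) [NeZero N] :
    letI : CStarAlgebra (Matrix (Fin N) (Fin N) ℂ) := {}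
    B7.Concl ((2 : ℕ) : ℝ) (cB 2 2) (C0 2) (c2' 2 2)
        (concreteOneStepBD (Matrix (Fin N) (Fin N) ℂ) (d := 2) 2)
        (fun k : ℕ => concreteKStep 2 (Matrix (Fin N) (Fin N) ℂ) (specialUnitaryUnits (Fin N)) 2 k)
        (concreteKExp (Matrix (Fin N) (Fin N) ℂ) (specialUnitaryUnits (Fin N)) (d := 2) 2)
        (concreteGaugeData (Matrix (Fin N) (Fin N) ℂ) (d := 2) 2)
        (concreteGaugeOneStep (Matrix (Fin N) (Fin N) ℂ) (d := 2) 2) ∧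
      (AvgClosed 2 2 (specialUnitaryUnits (Fin N)) ↔ N ≤ 25) := by
  letI : CStarAlgebra (Matrix (Fin N) (Fin N) ℂ) := {}
  exact ⟨concl_specialUnitary N 2 2 le_rfl, avgClosed_two_two_specialUnitary_iff⟩

end Precision

/-! ## §5 (Revision 2) THE EXACT `G`-DEPENDENT RADIUS FOR `G = SU(N)`: `t < 2 sin(π/N)` (cap `¼`)

`B7Prop2SpecialUnitary` §5 refutes closure at every radius `t ≥ 2π/N` with the central-element configuration `twistCfg N`; its comb
words are `Z = e^{2πi/N}·1` or `1`, and `|Z − 1|` is EXACTLY `2 sin(π/N)` (not just `≤ 2π/N`), so the same witness refutes every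
`t ≥ 2 sin(π/N)`, while §2 certifies every `t < 2 sin(π/N)` (`t ≤ ¼`).  Hence the radius of `SU(N)`-valuedness of the printed average (42)
at `d = 2`, `L = 2` is EXACTLY `min{¼, 2 sin(π/N)}` (open at the `sin` end), `N ≥ 2`. -/

section ExactRadius

open scoped Matrix.Norms.L2Operator

/-- `|Z − 1| = |e^{2πi/N} − 1| = 2 sin(π/N)` EXACTLY (operator norm (19); the tree's `norm_ZU_sub_one` is the bound `≤ 2π/N`).
[cite: Balaban1985Averaging, (19)–(24) p.21] -/
theorem norm_ZU_sub_one_eq (N : ℕ) [NeZero N] :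
    ‖(ZU N : Matrix (Fin N) (Fin N) ℂ) - 1‖ = 2 * Real.sin (Real.pi / N) := by
  have h1 : (ZU N : Matrix (Fin N) (Fin N) ℂ) - 1 =
      (Complex.exp (thetaN N) - 1) • (1 : Matrix (Fin N) (Fin N) ℂ) := by
    rw [sub_smul, one_smul, val_ZU]
  rw [h1, norm_smul, CStarRing.norm_one, mul_one, thetaN, mul_comm, Complex.norm_exp_I_mul_ofReal_sub_one,
    show (2 * Real.pi / N : ℝ) / 2 = Real.pi / N by ring, Real.norm_eq_abs, abs_of_nonneg]
  have hN1 : (1 : ℝ) ≤ N := by exact_mod_cast NeZero.one_le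
  have h0 : 0 ≤ Real.sin (Real.pi / N) :=
    Real.sin_nonneg_of_nonneg_of_le_pi (by positivity) (div_le_self Real.pi_pos.le hN1)
  linarith

/-- **`SU(N)`, `N ≥ 10`, is NOT closed under (42) at any radius `t ≥ 2 sin(π/N)`** (the tree's `not_avgClosedAt_specialUnitary`, whose
hypothesis `2π/N ≤ t` is relaxed to the exact `2 sin(π/N) ≤ t` by `norm_ZU_sub_one_eq`; same witness `twistCfg N`, same conclusion
`det V̄_c = −1`). [cite: Balaban1985Averaging, (42) p.23, p.20] -/
theorem not_avgClosedAt_specialUnitary_of_two_sin_le {N : ℕ} [NeZero N] (hN : 10 ≤ N) {t : ℝ}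
    (ht : 2 * Real.sin (Real.pi / N) ≤ t) : ¬ AvgClosedAt 2 t 2 (specialUnitaryUnits (Fin N)) := by
  intro hG
  have hN1 : (1 : ℝ) ≤ N := by exact_mod_cast NeZero.one_le
  have h0 : 0 ≤ 2 * Real.sin (Real.pi / N) :=
    mul_nonneg (by norm_num) (Real.sin_nonneg_of_nonneg_of_le_pi (by positivity) (div_le_self Real.pi_pos.le hN1))
  have hW : ∀ r : Fin 2 → Fin 2,
      ‖((Wcx 2 (twistCfg N) 0 0 (boxVec 2 r) : (Matrix (Fin N) (Fin N) ℂ)ˣ) : Matrix (Fin N) (Fin N) ℂ) - 1‖ ≤ t := by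
    intro r
    rw [Wcx_twistCfg]
    split_ifs
    · exact (norm_ZU_sub_one_eq N).le.trans ht
    · rw [Units.val_one, sub_self, norm_zero]
      exact h0.trans ht
  exact bavg_twistCfg_not_mem hN (hG.bavg_mem (twistCfg N) (twistCfg_mem N) 0 0 hW)

/-- **THE EXACT RADIUS DICHOTOMY for `G = SU(N)`, `N ≥ 2`, at `d = 2`, `L = 2`, radii `t ≤ ¼`:**
`AvgClosedAt 2 t 2 SU(N) ↔ t < 2 sin(π/N)` (`2 ≤ N ≤ 9`: both sides hold, `¼ < 2 sin(π/N)`; `N ≥ 10`: §2 and the relaxed §5 witness).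
So the `G`-dependent radius of [Balaban1985Averaging] p. 20 for `G = SU(N)` is exactly `min{¼, 2 sin(π/N)}` in the lineage's reading.
[cite: Balaban1985Averaging, (42) p.23, p.20, (22)–(23) p.21] -/
theorem avgClosedAt_two_two_specialUnitary_iff {N : ℕ} [NeZero N] (hN : 2 ≤ N) {t : ℝ} (ht4 : t ≤ 1 / 4) :
    AvgClosedAt 2 t 2 (specialUnitaryUnits (Fin N)) ↔ t < 2 * Real.sin (Real.pi / N) := by
  have hcard : (Fintype.card (Fin N) : ℝ) = N := by rw [Fintype.card_fin]
  by_cases h10 : 10 ≤ N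
  · refine ⟨fun h => lt_of_not_ge fun hle => not_avgClosedAt_specialUnitary_of_two_sin_le h10 hle h, fun h => ?_⟩
    exact avgClosedAt_specialUnitary_of_lt_two_sin 2 2 ht4 (by rw [hcard]; exact h)
  · have hlt : t < 2 * Real.sin (Real.pi / N) :=
      lt_of_le_of_lt ht4 (quarter_lt_two_sin_pi_div hN (by omega))
    exact ⟨fun _ => hlt, fun _ => avgClosedAt_specialUnitary_of_lt_two_sin 2 2 ht4 (by rw [hcard]; exact hlt)⟩

end ExactRadius

end Literature.MathematicalPhysics.QuantumFieldTheory.Balaban1983to89.B7AvgClosedSpecialUnitarySharp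

end
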